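import Summits.KontsevichZagierPeriods.KontsevichZagierPeriods.Theorems.FurushoPentagonKernelModuloPeriodConjectureLeafWeightLeSixteen
import Summits.KontsevichZagierPeriods.KontsevichZagierPeriods.Theorems.FurushoPentagonKernelModuloPeriodConjectureLeafOfCheckBlocksCX
import Summits.KontsevichZagierPeriods.KontsevichZagierPeriods.Theorems.FurushoPentagonKernelModuloPeriodConjectureEdsChainWeightSeventeenB
import Summits.KontsevichZagierPeriods.KontsevichZagierPeriods.Theorems.FurushoPentagonKernelModuloPeriodConjectureEdsBlockWeightSeventeenA
import Summits.KontsevichZagierPeriods.KontsevichZagierPeriods.Theorems.FurushoPentagonKernelModuloPeriodConjectureEdsBlockWeightSeventeenB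
import Summits.KontsevichZagierPeriods.KontsevichZagierPeriods.Theorems.FurushoPentagonKernelModuloPeriodConjectureEdsBlockWeightSeventeenC
import Summits.KontsevichZagierPeriods.KontsevichZagierPeriods.Theorems.FurushoPentagonKernelModuloPeriodConjectureEdsBlockWeightSeventeenD
import Summits.KontsevichZagierPeriods.KontsevichZagierPeriods.Theorems.FurushoPentagonKernelModuloPeriodConjectureEdsBlockWeightSeventeenE
import Summits.KontsevichZagierPeriods.KontsevichZagierPeriods.Theorems.FurushoPentagonKernelModuloPeriodConjectureEdsBlockWeightSeventeenF
import Summits.KontsevichZagierPeriods.KontsevichZagierPeriods.Theorems.FurushoPentagonKernelModuloPeriodConjectureEdsBlockWeightSeventeenG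
import Summits.KontsevichZagierPeriods.KontsevichZagierPeriods.Theorems.FurushoPentagonKernelModuloPeriodConjectureEdsBlockWeightSeventeenH
import Summits.KontsevichZagierPeriods.KontsevichZagierPeriods.Theorems.FurushoPentagonKernelModuloPeriodConjectureEdsBlockWeightSeventeenI
import Summits.KontsevichZagierPeriods.KontsevichZagierPeriods.Theorems.FurushoPentagonKernelModuloPeriodConjectureEdsBlockWeightSeventeenJ
import Summits.KontsevichZagierPeriods.KontsevichZagierPeriods.Theorems.FurushoPentagonKernelModuloPeriodConjectureEdsBlockWeightSeventeenK
import Summits.KontsevichZagierPeriods.KontsevichZagierPeriods.Theorems.FurushoPentagonKernelModuloPeriodConjectureEdsBlockWeightSeventeenL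
import Summits.KontsevichZagierPeriods.KontsevichZagierPeriods.Theorems.FurushoPentagonKernelModuloPeriodConjectureEdsBlockWeightSeventeenM
import Summits.KontsevichZagierPeriods.KontsevichZagierPeriods.Theorems.FurushoPentagonKernelModuloPeriodConjectureEdsBlockWeightSeventeenN
import Summits.KontsevichZagierPeriods.KontsevichZagierPeriods.Theorems.FurushoPentagonKernelModuloPeriodConjectureEdsBlockWeightSeventeenO
import Summits.KontsevichZagierPeriods.KontsevichZagierPeriods.Theorems.FurushoPentagonKernelModuloPeriodConjectureEdsBlockWeightSeventeenP
import Summits.KontsevichZagierPeriods.KontsevichZagierPeriods.Theorems.FurushoPentagonKernelModuloPeriodConjectureEdsBlockWeightSeventeenQ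
import Summits.KontsevichZagierPeriods.KontsevichZagierPeriods.Theorems.FurushoPentagonKernelModuloPeriodConjectureEdsBlockWeightSeventeenR
import Summits.KontsevichZagierPeriods.KontsevichZagierPeriods.Theorems.FurushoPentagonKernelModuloPeriodConjectureEdsBlockWeightSeventeenS
import Summits.KontsevichZagierPeriods.KontsevichZagierPeriods.Theorems.FurushoPentagonKernelModuloPeriodConjectureEdsBlockWeightSeventeenT
import Summits.KontsevichZagierPeriods.KontsevichZagierPeriods.Theorems.FurushoPentagonKernelModuloPeriodConjectureEdsBlockWeightSeventeenV
import Summits.KontsevichZagierPeriods.KontsevichZagierPeriods.Theorems.FurushoPentagonKernelModuloPeriodConjectureEdsBlockWeightSeventeenU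
import HarnessLib

/-!
# `KernelModuloPeriodConjecture`, line `Sketch`: Hoffman spanning for abstract associators, weight ≤ 17

Crux `FurushoPentagon.KernelModuloPeriodConjecture` (stmt-KontsevichZagierPeriods-15058), line
`Sketch`, lead c7. ONE citable theorem extending the weight `≤ 16` assembly
(`stub_associatorHoffmanSpanning_of_weight_le_16`) by weight `17`: for EVERY admissible index
`s` of weight `≤ 17` there is one finitely supported `b` on Hoffman indices of the same weight
with `c_{bw s}(φ) = Σ_t b_t c_{bw t}(φ)` at every group-like solution `φ` of Drinfeld's pentagon
over every commutative `ℚ`-algebra — the coordinate form of `GRT₁ ≅ U^{dR}_{MT(ℤ)}`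
(equivalently `𝔤𝔯𝔱₁ = 𝔤^𝔪`) in weights `≤ 17` for abstract associators, as a kernel-checked
theorem. Weight `17` (`2^15 − d_17` non-Hoffman admissible words) is Ihara–Kaneko–Zagier's
linearised extended double shuffle system reduced mod 2 in `22` CELL blocks (engine
`Literature/NumberTheory/Transcendental/LinEDSCells.lean`: a block is a union of cells = columns
of one depth with prescribed last parts, its bitset generated by a DP, so that no block exceeds
one gate elaboration slot although the exact-depth blocks of weight 17 have up to `C(15,7) = 6435`
columns): blocks (columns, slot width) A (1941, 19093, 115 precomputed fillers), B (1001, 10901, 99 precomputed fillers), C (1078, 8193), D (918, 4089), E (2002, 12287, 48 groups), F (2044, 8193), G (924, 3071), H (2079, 8193, 8 groups), I (1716, 6487), J (2092, 8193), K (540, 2049), L (1716, 6143, 11 groups), M (1716, 6143), N (1716, 6143), O (1287, 6143), P (1716, 6143, 3 groups), Q (2079, 12293), R (1210, 8193), S (2002, 12287), T (1001, 10901), V (1001, 10901), U (940, 9357); grouped rows where the natural rows of a block are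
rank-deficient mod 2, the two most deficient blocks with their filler rows precomputed and certified
by provenance files (`checkBlockCX`, `checkExtra`); chain condition `stub_chainOK_17b`; assembled by
the cell block master `stub_leaf_of_checkBlocksCX`. For comparison, the printed verifications of
IKZ's Conjecture 1 are numerical (IKZ) or ranks of the EDS matrix of REAL multiple zeta values
modulo a large prime (Kaneko–Noro–Tsurumaki 2008, weight ≤ 20); here the statement is for every
group-like solution of the pentagon over every commutative `ℚ`-algebra and is checked by Lean's
kernel.

References: K. Ihara, M. Kaneko, D. Zagier, Compos. Math. 142 (2006) §2, Conjecture 1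
[IharaKanekoZagier2006]; M. Kaneko, M. Noro, K. Tsurumaki, IMA Vol. Math. Appl. 148 (2008)
47–58; H. Furusho, Ann. of Math. 174 (2011) Thm 1.2 [Furusho2011]; F. Brown, Ann. of Math. 175
(2012) Thm 1.1 [Brown2012]; V. Drinfeld, Leningrad Math. J. 2 (1991).
-/

namespace Summit.KontsevichZagierPeriods.FurushoPentagon.KernelModuloPeriodConjecture

open Literature.NumberTheory.Transcendental

/-- **The weight-17 slice of the algebraic leaf**: Hoffman spanning for every admissible index of
weight `17` at every group-like pentagon solution, from the `22` cell block certificates and the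
chain condition `stub_chainOK_17b` by the cell block master (plain blocks `checkBlockC`, blocks with
precomputed fillers `checkBlockCX` + provenance). [cite: IharaKanekoZagier2006, Conjecture 1] -/
theorem leafWeightSeventeen (s : List ℕ) (hs : MZV.IsAdmissible s) (hw : MZV.weight s = 17) :
    ∃ b : List ℕ →₀ ℚ, (∀ t ∈ b.support, MZV.IsHoffman t ∧ MZV.weight t = MZV.weight s) ∧ ∀ (R : Type) [CommRing R] [Algebra ℚ R] [IsReduced R] (φ : NCSeries Bool R), NCSeries.IsGroupLike φ → NCSeries.DrinfeldPentagon φ → φ (MZV.binaryWord s) = b.sum (fun t q => q • φ (MZV.binaryWord t)) := by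
  refine stub_leaf_of_checkBlocksCX 17 _ (by norm_num) stub_chainOK_17b (fun p hp => ?_) s hs hw
  simp only [List.mem_cons, List.not_mem_nil, or_false] at hp
  rcases hp with rfl | rfl | rfl | rfl | rfl | rfl | rfl | rfl | rfl | rfl | rfl | rfl | rfl | rfl | rfl | rfl | rfl | rfl | rfl | rfl | rfl | rfl
  · exact Or.inr stub_edsBlockCX_17_A
  · exact Or.inr stub_edsBlockCX_17_B
  · exact Or.inl stub_edsBlockC_17_C
  · exact Or.inl stub_edsBlockC_17_D
  · exact Or.inl stub_edsBlockC_17_E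
  · exact Or.inl stub_edsBlockC_17_F
  · exact Or.inl stub_edsBlockC_17_G
  · exact Or.inl stub_edsBlockC_17_H
  · exact Or.inl stub_edsBlockC_17_I
  · exact Or.inl stub_edsBlockC_17_J
  · exact Or.inl stub_edsBlockC_17_K
  · exact Or.inl stub_edsBlockC_17_L
  · exact Or.inl stub_edsBlockC_17_M
  · exact Or.inl stub_edsBlockC_17_N
  · exact Or.inl stub_edsBlockC_17_O
  · exact Or.inl stub_edsBlockC_17_P
  · exact Or.inl stub_edsBlockC_17_Q
  · exact Or.inl stub_edsBlockC_17_R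
  · exact Or.inl stub_edsBlockC_17_S
  · exact Or.inl stub_edsBlockC_17_T
  · exact Or.inl stub_edsBlockC_17_V
  · exact Or.inl stub_edsBlockC_17_U

/-- **Registered stub `stub_associatorHoffmanSpanning_of_weight_le_17`** (lead c7; crux
stmt-KontsevichZagierPeriods-15058, line `Sketch`): the algebraic leaf `AssociatorHoffmanSpanning`
for every admissible index of weight at most `17` — weight `≤ 16` is the tree theorem
`stub_associatorHoffmanSpanning_of_weight_le_16`, weight `17` is `leafWeightSeventeen`.
[cite: IharaKanekoZagier2006, Conjecture 1] -/
theorem stub_associatorHoffmanSpanning_of_weight_le_17 :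
    ∀ s : List ℕ, MZV.IsAdmissible s → MZV.weight s ≤ 17 →
      ∃ b : List ℕ →₀ ℚ, (∀ t ∈ b.support, MZV.IsHoffman t ∧ MZV.weight t = MZV.weight s) ∧ ∀ (R : Type) [CommRing R] [Algebra ℚ R] [IsReduced R] (φ : NCSeries Bool R), NCSeries.IsGroupLike φ → NCSeries.DrinfeldPentagon φ → φ (MZV.binaryWord s) = b.sum (fun t q => q • φ (MZV.binaryWord t)) := by
  intro s hs h17
  by_cases h16 : MZV.weight s ≤ 16
  · exact stub_associatorHoffmanSpanning_of_weight_le_16 s hs h16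
  · exact leafWeightSeventeen s hs (by omega)

end Summit.KontsevichZagierPeriods.FurushoPentagon.KernelModuloPeriodConjecture
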